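import Summits.HubbardSuperconductivity.HubbardSuperconductivity.Theorems.KLProgrammeKLRegimeScaleZeroCovarianceFarSiteWindow
import Summits.HubbardSuperconductivity.HubbardSuperconductivity.Theorems.KLProgrammeKLRegimeScaleZeroCovarianceOffSiteContrForm
import Summits.HubbardSuperconductivity.HubbardSuperconductivity.Theorems.KLProgrammeKLRegimeFlowReadScaleZeroSunsetCertDefsV2
import Summits.HubbardSuperconductivity.HubbardSuperconductivity.Theorems.KLProgrammeKLRegimeScaleZeroDetBoundFreeBandSharp
import Summits.HubbardSuperconductivity.HubbardSuperconductivity.Theorems.KLProgrammeKLRegimeScaleZeroLatticeSumNumeral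

/-!
# Route `KLProgramme`, crux K3 — engine-flow child (stmt-HubbardSuperconductivity-20437), stub (C) at `n = 0`, located item #22a «(C)-SCALE0-PT2»,
# the FAR-SITE supplier, pieces (F-a)/(F-e)/(F-f): THE FAR ROWS `hfar` of the record reader from a momentum-jet envelope

Seat hubbard-kl-k3c5-p1 (g14; owner of #22a).  `…FlowReadScaleZeroSunsetCertRows.sunsetRows_of_certV3` reads the assembly's certified sunset rows from a
μ-cell record MODULO the far-site remainder `hfar k` (sites whose centred difference `z_c` lies outside the certified disk).  This file SUPPLIES `hfar k`
(k = 0, 1, 2) from ONE momentum-jet envelope of the scale-0 symbol, `‖Dⁿ g_{μ,ω}(y)‖ ≤ Jn/max(|ω|, klE0/2)²` (`ω ≠ 0`; the far certificate's clause,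
one kit-certified number `Jn`), with NO profiles, NO octave table, NO time-decay estimate and NO factorial-Cauchy table:
* §1 `gridCov_apply_spin_eq` — the entry does not depend on the spin (D7), so `‖A₃‖ = ‖A₁‖`; with the Gram bound `‖A₂‖ ≤ 16`
  (`isGramBoundedR_scaleZero_free_sharp_klEngL₃`, `L ≥ klEngL₃`) the far summand is `≤ 16·w_k(z_c)·‖A₁‖²`;
* §2 `sqrt_natAbs_sq_le`, `one_add_norm_ge_of_not_mem_disk` — the Euclidean weight is `≤ (2(1+‖z_c‖∞))ᵏ`; a far `z_c ≠ 0` has `1+‖z_c‖∞ ≥ Rc+2`;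
* §3 **`farRows_le_of_jets`** — THE FAR ROWS: by the time-ℓ² bound `…FarSiteWindow.sum_normSq_gridCov_offSite_le_of_jets` (time-grid Parseval + per-frequency
  jet decay + β-uniform frequency sum) per far site, the injection `x₁ ↦ z_c` into `ℤ²` and the lattice numeral `S₄ ≤ 9`:
  `hfar k` holds with **`bFar k = 16·2ᵏ·9·(Jn²/(klE0/2)³)·((1+4ⁿSₙ)/πⁿ)²·(Rc+2)^{−(2n−4−k)}`** — β-, M-, L-uniform.
With this file #22a's rows `hS0/hS1/hS2` are theorems modulo TWO certificate predicates only: `ScaleZeroSunsetCertV3 c` (near disk) and the jet envelope (far).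

No definitions; nothing here asserts (C), any stub of 20437, K3 or superconductivity.
References: BGM 2006 §2.3 (2.17)–(2.20), (2.80), §3 (3.2) [cite: BenfattoGiulianiMastropietro2006].
-/

noncomputable section

namespace Summit.HubbardSuperconductivity.HubbardSuperconductivity.Theorems.KLRegimeSplit

set_option linter.dupNamespace false -- summit = problem name (single-conjunct summit), D-0017

open Literature.MathematicalPhysics.QuantumLattice Literature.Probability.LatticeModels Literature.Analysis.FunctionSpaces
open Summit.HubbardSuperconductivity.HubbardSuperconductivity.Theorems.DispersionFlow
open Summit.HubbardSuperconductivity.HubbardSuperconductivity.Theorems.EngineV8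
open MeasureTheory Set Finset Complex UnitAddTorus Real GrassmannAlgebra Matrix
open scoped FourierTransform Nat ENNReal NNReal

variable {L M : ℕ} [NeZero L]

/-! ## §1 Spin independence of the grid covariance entry -/

/-- **The `(+,−)` entry of the bare-frame grid covariance does not depend on the spin** (D7: both spins read the same frequency sum). -/
theorem gridCov_apply_spin_eq {β : ℝ} (hβ : 0 < β) (μ Λ : ℝ) {N : ℕ} (p₁ p₀ : GridPoint L N) (σ σ' : Fin 2) :
    ((hubbardGridSub L M β N).transpose * hubbardCovAboveCT L M β μ 0 0 Λ * hubbardGridSub L M β N) ((p₁, σ), 0) ((p₀, σ), 1) =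
      ((hubbardGridSub L M β N).transpose * hubbardCovAboveCT L M β μ 0 0 Λ * hubbardGridSub L M β N) ((p₁, σ'), 0) ((p₀, σ'), 1) := by
  rw [gridCov_hubbardCovAboveCT_apply_eq_sum_freqTerm hβ μ Λ p₁ p₀ σ, gridCov_hubbardCovAboveCT_apply_eq_sum_freqTerm hβ μ Λ p₁ p₀ σ']

/-! ## §2 The Euclidean weight and the far condition in terms of the centred representative -/

omit [NeZero L] in
/-- `√(|z₀|² + |z₁|²) ≤ 2(1 + ‖z‖∞)` for `z ∈ ℤ²` (integer coordinates through `natAbs`, as in the assembly's weight). -/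
theorem sqrt_natAbs_sq_le (z : Site 2) :
    Real.sqrt (((z 0).natAbs : ℝ) ^ 2 + ((z 1).natAbs : ℝ) ^ 2) ≤ 2 * (1 + ‖z‖) := by
  have h0 : |((z 0 : ℤ) : ℝ)| ≤ ‖z‖ := by rw [← Int.norm_eq_abs, ← Int.norm_cast_real]; exact norm_le_pi_norm z 0
  have h1 : |((z 1 : ℤ) : ℝ)| ≤ ‖z‖ := by rw [← Int.norm_eq_abs, ← Int.norm_cast_real]; exact norm_le_pi_norm z 1
  have hz : 0 ≤ ‖z‖ := norm_nonneg _
  rw [Nat.cast_natAbs, Nat.cast_natAbs, Int.cast_abs, Int.cast_abs]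
  calc Real.sqrt (|((z 0 : ℤ) : ℝ)| ^ 2 + |((z 1 : ℤ) : ℝ)| ^ 2) ≤ Real.sqrt ((2 * (1 + ‖z‖)) ^ 2) := by
        refine Real.sqrt_le_sqrt ?_
        have ha := abs_nonneg (((z 0 : ℤ) : ℝ)); have hb := abs_nonneg (((z 1 : ℤ) : ℝ))
        nlinarith
    _ = 2 * (1 + ‖z‖) := Real.sqrt_sq (by positivity)

omit [NeZero L] in
/-- A nonzero `z ∈ ℤ²` outside the certified disk `{0 < ‖z‖∞ ≤ Rc}` has `Rc + 2 ≤ 1 + ‖z‖∞`. -/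
theorem one_add_norm_ge_of_not_mem_disk (c : SunsetCellRecordV2) {z : Site 2} (hz0 : z ≠ 0) (hz : z ∉ c.disk) :
    (c.Rc : ℝ) + 2 ≤ 1 + ‖z‖ := by
  rw [SunsetCellRecordV2.mem_disk, not_and_or] at hz
  rcases hz with h | h
  · rw [not_forall] at h
    obtain ⟨j, hj⟩ := h
    rw [not_and_or, not_le, not_le] at hj
    have hjz : (c.Rc : ℝ) + 1 ≤ |((z j : ℤ) : ℝ)| := by
      rw [← Int.cast_abs]
      have : (c.Rc : ℤ) + 1 ≤ |z j| := by
        rcases hj with hj | hj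
        · rw [abs_of_neg (by omega)]; omega
        · rw [abs_of_pos (by omega)]; omega
      exact_mod_cast this
    have hnorm : |((z j : ℤ) : ℝ)| ≤ ‖z‖ := by rw [← Int.norm_eq_abs, ← Int.norm_cast_real]; exact norm_le_pi_norm z j
    linarith
  · exact absurd hz0 (by simpa using h)

/-! ## §3 The far rows -/

/-- **THE FAR ROWS `hfar` OF THE RECORD READER FROM A JET ENVELOPE** (bare frame; `μ ∈ klWindowC`, `β ≥ klBetaMin`, `L ≥ klEngL₃ β U` for the Gram
bound 16; `n ≥ 4`; the envelope `‖Dⁿ g_{μ,ω}(y)‖ ≤ Jn/max(|ω|, klE0/2)²` for `ω ≠ 0`): for every record `c` (only its disk radius `Rc` matters), every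
`k : Fin 3`, spin `σ` and base point `p₀`, the far part of the assembly's `k`-weighted sunset row is
`≤ [16·2ᵏ·9·(Jn²/(klE0/2)³)·((1+4ⁿSₙ)/πⁿ)²·(Rc+2)^{−(2n−4−k)}]·(4M/β)`. -/
theorem farRows_le_of_jets [NeZero M] (c : SunsetCellRecordV2) {μ U β : ℝ} (hμ : μ ∈ klWindowC) (hβ : klBetaMin ≤ β) (hL : klEngL₃ β U ≤ L)
    {n : ℕ} (hn : 2 * 2 ≤ n) {Jn : ℝ}
    (hJ : ∀ om : ℝ, om ≠ 0 → ∀ y : Momentum,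
      ‖iteratedFDeriv ℝ n (fun y : Momentum => uvSymbolFn 1 klE0 (frameLevel μ 0 ((2 * π) • y)) om) y‖ ≤ Jn / max |om| (klE0 / 2) ^ 2)
    (k : Fin 3) (σ : Fin 2) (p₀ : GridPoint L (2 * (2 * M))) :
    ∑ p₁ : GridPoint L (2 * (2 * M)),
      (if p₁.2 ≠ p₀.2 ∧ (fun j => ((p₁.2 - p₀.2) j).valMinAbs : Site 2) ∉ c.disk then
        Real.sqrt ((((p₁.2 - p₀.2) 0).valMinAbs.natAbs : ℝ) ^ 2 + (((p₁.2 - p₀.2) 1).valMinAbs.natAbs : ℝ) ^ 2) ^ (k : ℕ) *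
          ‖contr ℂ ((hubbardGridSub L M β (2 * (2 * M))).transpose * hubbardCovAboveCT L M β μ 0 0 klE0 *
                hubbardGridSub L M β (2 * (2 * M))) (((p₁, σ), 0) : GridLeg (GridPoint L (2 * (2 * M)))) ((p₀, σ), 1) *
              (contr ℂ ((hubbardGridSub L M β (2 * (2 * M))).transpose * hubbardCovAboveCT L M β μ 0 0 klE0 *
                hubbardGridSub L M β (2 * (2 * M))) (((p₀, σ.rev), 0) : GridLeg (GridPoint L (2 * (2 * M)))) ((p₁, σ.rev), 1) *
                contr ℂ ((hubbardGridSub L M β (2 * (2 * M))).transpose * hubbardCovAboveCT L M β μ 0 0 klE0 *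
                hubbardGridSub L M β (2 * (2 * M))) (((p₁, σ.rev), 0) : GridLeg (GridPoint L (2 * (2 * M)))) ((p₀, σ.rev), 1))‖
        else 0) ≤
      (16 * 2 ^ (k : ℕ) * 9 * ((Jn ^ 2 / (klE0 / 2) ^ 3) * ((1 + (4 : ℝ) ^ n * ∑' q : Site 2, ((1 + ‖q‖) ^ n)⁻¹) / Real.pi ^ n) ^ 2) *
          (((c.Rc : ℝ) + 2) ^ (2 * n - 4 - (k : ℕ)))⁻¹) * (((2 * (2 * M) : ℕ) : ℝ) / β) := by
  classical
  have hβ₀ : (0 : ℝ) < klBetaMin := by norm_num [klBetaMin]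
  have hβpos : 0 < β := lt_of_lt_of_le hβ₀ hβ
  have hMpos : 0 < M := Nat.pos_of_ne_zero (NeZero.ne M)
  have hN : 0 < 2 * (2 * M) := by positivity
  have hNβ : 0 < (((2 * (2 * M) : ℕ) : ℝ) / β) := by positivity
  have ha : (0 : ℝ) < klE0 / 2 := by norm_num [klE0]
  have hk2 : (k : ℕ) ≤ 2 := by have := k.isLt; omega
  set Cg := (hubbardGridSub L M β (2 * (2 * M))).transpose * hubbardCovAboveCT L M β μ 0 0 klE0 * hubbardGridSub L M β (2 * (2 * M)) with hCg
  -- the Gram bound 16 on every entry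
  have hGB := isGramBoundedR_scaleZero_free_sharp_klEngL₃ (L := L) (M := M) hμ hβ hL
  have h16 : Real.sqrt (2 * (7 + 1)) ^ 2 = 16 := by rw [Real.sq_sqrt (by norm_num)]; norm_num
  have hA16 : ∀ X Y : GridLeg (GridPoint L (2 * (2 * M))), ‖Cg X Y‖ ≤ 16 := fun X Y => by
    rw [← norm_contr_gridCov_hubbardCovAboveCT β μ klE0 0 (2 * (2 * M)) X Y, contr_apply, ← h16]
    exact IsGramBoundedR.norm_pairing_le hGB X Y
  -- constants
  set G : ℝ := (Jn ^ 2 / (klE0 / 2) ^ 3) * ((1 + (4 : ℝ) ^ n * ∑' q : Site 2, ((1 + ‖q‖) ^ n)⁻¹) / Real.pi ^ n) ^ 2 with hG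
  have hS : 0 ≤ ∑' q : Site 2, ((1 + ‖q‖) ^ n)⁻¹ := tsum_nonneg fun q => by positivity
  have hG0 : 0 ≤ G := by positivity
  set B : ℝ := 16 * 2 ^ (k : ℕ) * G * (((c.Rc : ℝ) + 2) ^ (2 * n - 4 - (k : ℕ)))⁻¹ with hB
  have hB0 : 0 ≤ B := by positivity
  -- centred representative
  set zc : TorusSite 2 L → Site 2 := fun x => fun j => ((x - p₀.2) j).valMinAbs with hzc
  have hproj : ∀ x : TorusSite 2 L, Torus.proj L (zc x) = x - p₀.2 := fun x => (two_mul_norm_valMinAbs_le (x - p₀.2)).1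
  have hzc0 : ∀ x : TorusSite 2 L, x ≠ p₀.2 → zc x ≠ 0 := by
    intro x hx h0
    apply hx
    have h := hproj x
    rw [h0] at h
    have : Torus.proj L (0 : Site 2) = 0 := by funext j; simp [Literature.Probability.LatticeModels.Torus.proj_apply]
    rw [this] at h
    exact (sub_eq_zero.1 h.symm)
  -- Step 1: sites outside, times inside
  rw [Fintype.sum_prod_type, Finset.sum_comm]
  -- Step 2: per far site, `Σ_{j₁} w‖A₁(A₂A₃)‖ ≤ (4M/β)·B·(1+‖z_c‖)⁻⁴`
  have hsite : ∀ x : TorusSite 2 L,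
      ∑ j₁ : Fin (2 * (2 * M)), (if ((j₁, x) : GridPoint L (2 * (2 * M))).2 ≠ p₀.2 ∧
          (fun j => ((((j₁, x) : GridPoint L (2 * (2 * M))).2 - p₀.2) j).valMinAbs : Site 2) ∉ c.disk then
        Real.sqrt ((((((j₁, x) : GridPoint L (2 * (2 * M))).2 - p₀.2) 0).valMinAbs.natAbs : ℝ) ^ 2 +
            (((((j₁, x) : GridPoint L (2 * (2 * M))).2 - p₀.2) 1).valMinAbs.natAbs : ℝ) ^ 2) ^ (k : ℕ) *
          ‖contr ℂ Cg ((((j₁, x), σ), 0) : GridLeg (GridPoint L (2 * (2 * M)))) ((p₀, σ), 1) *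
              (contr ℂ Cg (((p₀, σ.rev), 0) : GridLeg (GridPoint L (2 * (2 * M)))) (((j₁, x), σ.rev), 1) *
                contr ℂ Cg ((((j₁, x), σ.rev), 0) : GridLeg (GridPoint L (2 * (2 * M)))) ((p₀, σ.rev), 1))‖
        else 0) ≤
      if x ≠ p₀.2 ∧ zc x ∉ c.disk then (((2 * (2 * M) : ℕ) : ℝ) / β) * B * ((1 + ‖zc x‖) ^ 4)⁻¹ else 0 := by
    intro x
    by_cases hcond : x ≠ p₀.2 ∧ zc x ∉ c.disk
    · simp only [hzc] at hcond ⊢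
      simp only [hcond, and_self, if_true, ne_eq, not_false_eq_true]
      -- the weight
      set w : ℝ := Real.sqrt ((((x - p₀.2) 0).valMinAbs.natAbs : ℝ) ^ 2 + (((x - p₀.2) 1).valMinAbs.natAbs : ℝ) ^ 2) ^ (k : ℕ) with hw
      have hw0 : 0 ≤ w := by positivity
      have hzn : (c.Rc : ℝ) + 2 ≤ 1 + ‖zc x‖ := one_add_norm_ge_of_not_mem_disk c (hzc0 x hcond.1) hcond.2
      have h1z : 1 ≤ 1 + ‖zc x‖ := by linarith [norm_nonneg (zc x)]
      have hwle : w ≤ (2 * (1 + ‖zc x‖)) ^ (k : ℕ) := by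
        rw [hw]; exact pow_le_pow_left₀ (Real.sqrt_nonneg _) (sqrt_natAbs_sq_le (zc x)) _
      -- the three factors: ‖A₃‖ = ‖A₁‖, ‖A₂‖ ≤ 16
      have htriple : ∀ j₁ : Fin (2 * (2 * M)),
          ‖contr ℂ Cg ((((j₁, x), σ), 0) : GridLeg (GridPoint L (2 * (2 * M)))) ((p₀, σ), 1) *
              (contr ℂ Cg (((p₀, σ.rev), 0) : GridLeg (GridPoint L (2 * (2 * M)))) (((j₁, x), σ.rev), 1) *
                contr ℂ Cg ((((j₁, x), σ.rev), 0) : GridLeg (GridPoint L (2 * (2 * M)))) ((p₀, σ.rev), 1))‖ ≤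
            16 * ‖Cg ((((j₁, x), σ), 0) : GridLeg (GridPoint L (2 * (2 * M)))) ((p₀, σ), 1)‖ ^ 2 := by
        intro j₁
        rw [norm_mul, norm_mul, norm_contr_gridCov_hubbardCovAboveCT, norm_contr_gridCov_hubbardCovAboveCT, norm_contr_gridCov_hubbardCovAboveCT,
          hCg, ← gridCov_apply_spin_eq hβpos μ klE0 ((j₁, x) : GridPoint L (2 * (2 * M))) p₀ σ σ.rev]
        have h2 := hA16 ((p₀, σ.rev), 0) (((j₁, x), σ.rev), 1)
        have hn1 := norm_nonneg (Cg ((((j₁, x), σ), 0) : GridLeg (GridPoint L (2 * (2 * M)))) ((p₀, σ), 1))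
        rw [hCg] at h2 hn1
        nlinarith
      -- the time-ℓ² from the jets
      have hl2 := sum_normSq_gridCov_offSite_le_of_jets (L := L) hβpos hMpos μ hn ha hJ p₀ hcond.1 σ
      calc ∑ j₁ : Fin (2 * (2 * M)), w * ‖contr ℂ Cg ((((j₁, x), σ), 0) : GridLeg (GridPoint L (2 * (2 * M)))) ((p₀, σ), 1) *
              (contr ℂ Cg (((p₀, σ.rev), 0) : GridLeg (GridPoint L (2 * (2 * M)))) (((j₁, x), σ.rev), 1) *
                contr ℂ Cg ((((j₁, x), σ.rev), 0) : GridLeg (GridPoint L (2 * (2 * M)))) ((p₀, σ.rev), 1))‖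
          ≤ ∑ j₁ : Fin (2 * (2 * M)), w * (16 * ‖Cg ((((j₁, x), σ), 0) : GridLeg (GridPoint L (2 * (2 * M)))) ((p₀, σ), 1)‖ ^ 2) :=
            Finset.sum_le_sum fun j₁ _ => mul_le_mul_of_nonneg_left (htriple j₁) hw0
        _ = w * 16 * ∑ j₁ : Fin (2 * (2 * M)), ‖Cg ((((j₁, x), σ), 0) : GridLeg (GridPoint L (2 * (2 * M)))) ((p₀, σ), 1)‖ ^ 2 := by
            rw [Finset.mul_sum]; refine Finset.sum_congr rfl fun j₁ _ => ?_; ring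
        _ ≤ (2 * (1 + ‖zc x‖)) ^ (k : ℕ) * 16 * ((((2 * (2 * M) : ℕ) : ℝ) / β) * (G * (((1 + ‖zc x‖) ^ n)⁻¹) ^ 2)) := by
            gcongr
        _ ≤ (((2 * (2 * M) : ℕ) : ℝ) / β) * B * ((1 + ‖zc x‖) ^ 4)⁻¹ := by
            -- `(1+‖z‖)^k/(1+‖z‖)^{2n} ≤ (Rc+2)^{−(2n−4−k)}(1+‖z‖)^{−4}`
            have hsplit : (1 + ‖zc x‖) ^ (2 * n) = (1 + ‖zc x‖) ^ (k : ℕ) * (1 + ‖zc x‖) ^ 4 * (1 + ‖zc x‖) ^ (2 * n - 4 - (k : ℕ)) := by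
              rw [← pow_add, ← pow_add]; congr 1; omega
            have hRc : ((c.Rc : ℝ) + 2) ^ (2 * n - 4 - (k : ℕ)) ≤ (1 + ‖zc x‖) ^ (2 * n - 4 - (k : ℕ)) :=
              pow_le_pow_left₀ (by positivity) hzn _
            have hRc0 : (0 : ℝ) < ((c.Rc : ℝ) + 2) ^ (2 * n - 4 - (k : ℕ)) := by positivity
            rw [hB, show (((1 + ‖zc x‖) ^ n)⁻¹) ^ 2 = ((1 + ‖zc x‖) ^ (2 * n))⁻¹ by rw [← inv_pow, ← pow_mul, mul_comm, inv_pow], hsplit]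
            have h1zk : 0 < (1 + ‖zc x‖) ^ (k : ℕ) := by positivity
            have h1z4 : 0 < (1 + ‖zc x‖) ^ 4 := by positivity
            have h1zr : 0 < (1 + ‖zc x‖) ^ (2 * n - 4 - (k : ℕ)) := by positivity
            rw [mul_inv, mul_inv]
            calc (2 * (1 + ‖zc x‖)) ^ (k : ℕ) * 16 * ((((2 * (2 * M) : ℕ) : ℝ) / β) *
                  (G * (((1 + ‖zc x‖) ^ (k : ℕ))⁻¹ * ((1 + ‖zc x‖) ^ 4)⁻¹ * ((1 + ‖zc x‖) ^ (2 * n - 4 - (k : ℕ)))⁻¹)))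
                = (((2 * (2 * M) : ℕ) : ℝ) / β) * (16 * 2 ^ (k : ℕ) * G * ((1 + ‖zc x‖) ^ (2 * n - 4 - (k : ℕ)))⁻¹) * ((1 + ‖zc x‖) ^ 4)⁻¹ := by
                  rw [mul_pow]; field_simp
              _ ≤ (((2 * (2 * M) : ℕ) : ℝ) / β) * (16 * 2 ^ (k : ℕ) * G * (((c.Rc : ℝ) + 2) ^ (2 * n - 4 - (k : ℕ)))⁻¹) * ((1 + ‖zc x‖) ^ 4)⁻¹ := by
                  gcongr
    · simp only [hzc] at hcond ⊢
      simp only [hcond, if_false]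
      simp
  refine (Finset.sum_le_sum fun x _ => hsite x).trans ?_
  -- Step 3: the lattice tail through the injection `x ↦ z_c`
  rw [← Finset.sum_filter]
  have hinj : Set.InjOn zc ↑(Finset.univ.filter fun x : TorusSite 2 L => x ≠ p₀.2 ∧ zc x ∉ c.disk) := by
    intro x _ y _ hxy
    have h := congrArg (Torus.proj L) hxy
    rw [hproj x, hproj y] at h
    exact sub_left_injective h
  have hsum4 := summable_inv_one_add_norm_pow (d := 2) (K := 4) (by norm_num)
  calc ∑ x ∈ Finset.univ.filter (fun x : TorusSite 2 L => x ≠ p₀.2 ∧ zc x ∉ c.disk), (((2 * (2 * M) : ℕ) : ℝ) / β) * B * ((1 + ‖zc x‖) ^ 4)⁻¹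
      = (((2 * (2 * M) : ℕ) : ℝ) / β) * B * ∑ x ∈ Finset.univ.filter (fun x : TorusSite 2 L => x ≠ p₀.2 ∧ zc x ∉ c.disk), ((1 + ‖zc x‖) ^ 4)⁻¹ := by
        rw [Finset.mul_sum]
    _ = (((2 * (2 * M) : ℕ) : ℝ) / β) * B * ∑ z ∈ (Finset.univ.filter fun x : TorusSite 2 L => x ≠ p₀.2 ∧ zc x ∉ c.disk).image zc,
          ((1 + ‖z‖) ^ 4)⁻¹ := by rw [Finset.sum_image hinj]
    _ ≤ (((2 * (2 * M) : ℕ) : ℝ) / β) * B * ∑' z : Site 2, ((1 + ‖z‖) ^ 4)⁻¹ :=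
        mul_le_mul_of_nonneg_left (hsum4.sum_le_tsum _ fun z _ => by positivity) (by positivity)
    _ ≤ (((2 * (2 * M) : ℕ) : ℝ) / β) * B * 9 :=
        mul_le_mul_of_nonneg_left (tsum_inv_one_add_norm_pow_le_nine le_rfl) (by positivity)
    _ = (16 * 2 ^ (k : ℕ) * 9 * G * (((c.Rc : ℝ) + 2) ^ (2 * n - 4 - (k : ℕ)))⁻¹) * (((2 * (2 * M) : ℕ) : ℝ) / β) := by
        rw [hB]; ring

end Summit.HubbardSuperconductivity.HubbardSuperconductivity.Theorems.KLRegimeSplit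

end
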